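import Summits.HubbardSuperconductivity.HubbardSuperconductivity.Theorems.AnisotropyChordTransferTheorem

/-!
# Route `AnisotropyChord` / H0 rotor rung, route (1): LEMMA E, step 1 — the LADDER EXCESS IDENTITY
# `⟨S^±a, H S^±a⟩ − E‖S^±a‖² = (1−Δ)·(⟨S^±a, W S^±a⟩ − ⟨S^±a, S^±(W a)⟩)`
(prover seat `hubbard-h0-rotor-p1` g13; theory seat `hubbard-h0-rotor-theory-1` THEOREM-T.md «LEMMA E», memo ROTOR-THEORY-11 §175)

For a Perron sector ground amplitude `a` of `H(Δ) = A + (1−Δ)W − D/8` (tree: `xxz_mulVec_real_apply`, `perron_eigen_real`):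
`A` commutes with `S^±` (`raiseSum_fmOp`, `lowerSum_fmOp`), so only the anisotropy `(1−Δ)W` contributes to the ladder excess:
`ladderExcess_raise`, `ladderExcess_lower`.  Hence LEMMA E `LadderExcessBound` ⇔ the purely diagonal-operator inequality
`W⁺(a) + W⁻(a) ≤ 4L²` for `Δ ≤ 1` (`W^±(a) = ⟨S^±a, W S^±a⟩ − ⟨S^±a, S^±(Wa)⟩`; paper: `= ⟨a, D a⟩`, `D = Σ_b[2(SˣSˣ+SʸSʸ) − 4SᶻSᶻ]`,
the double commutator `[S⁻,[W,S⁺]]`) — `ladderExcessBound_of_commutatorBound`.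
-/

set_option linter.dupNamespace false
set_option autoImplicit false

noncomputable section

open Finset Filter Topology
open Literature.MathematicalPhysics.QuantumLattice Literature.Probability.LatticeModels
open Summit.HubbardSuperconductivity.HubbardSuperconductivity.Theorems.AnisotropyChord.InsertionEntropy
open Summit.HubbardSuperconductivity.HubbardSuperconductivity.Theorems.AnisotropyChord.Tower
open Summit.HubbardSuperconductivity.HubbardSuperconductivity.Theorems.AnisotropyChord

namespace Summit.HubbardSuperconductivity.HubbardSuperconductivity.Theorems.AnisotropyChord.Transfer

section General

variable {V : Type} [Fintype V] [DecidableEq V] (G : SimpleGraph V) [DecidableRel G.Adj]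

/-- the diagonal anisotropy operator on amplitudes: `(W b)(τ) = isingW τ · b τ`. [folklore] -/
def wMul (b : (V → Fin 2) → ℝ) : (V → Fin 2) → ℝ := fun τ => isingW G τ * b τ

/-- `W⁺(b) = ⟨S⁺b, W S⁺b⟩ − ⟨S⁺b, S⁺(W b)⟩` (the anisotropy commutator seen by the raising ladder). [folklore] -/
def raiseCommW (b : (V → Fin 2) → ℝ) : ℝ :=
  ∑ σ, isingW G σ * raiseSum b σ ^ 2 - ∑ σ, raiseSum b σ * raiseSum (wMul G b) σ

/-- `W⁻(b) = ⟨S⁻b, W S⁻b⟩ − ⟨S⁻b, S⁻(W b)⟩`. [folklore] -/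
def lowerCommW (b : (V → Fin 2) → ℝ) : ℝ :=
  ∑ σ, isingW G σ * lowerSum b σ ^ 2 - ∑ σ, lowerSum b σ * lowerSum (wMul G b) σ

end General

section Torus

variable {L : ℕ} [NeZero L]

/-- the eigen-equation solved for `A a`: `fmOp a = (E + D/8)·a − (1−Δ)·W a` for a Perron amplitude. [folklore] -/
theorem fmOp_perron_eq {Δ M : ℝ} {a : TensorIndex (TorusSite 2 L) 2 → ℝ} (ha : IsPerronSectorGroundAmplitude L Δ M a) :
    fmOp (torusGraph 2 L) a = fun τ =>
      (sectorE L Δ M + (1/8 : ℝ) * ∑ x : TorusSite 2 L, ∑ y, if (torusGraph 2 L).Adj x y then (1:ℝ) else 0) * a τ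
        - (1 - Δ) * wMul (torusGraph 2 L) a τ := by
  funext τ
  have h := perron_eigen_real ha τ
  unfold wMul sectorE ham
  linarith

/-- **LADDER EXCESS IDENTITY (raising):** `⟨S⁺a, H S⁺a⟩ − E(M)‖S⁺a‖² = (1−Δ)·W⁺(a)`. [folklore] -/
theorem ladderExcess_raise {Δ M : ℝ} {a : TensorIndex (TorusSite 2 L) 2 → ℝ} (ha : IsPerronSectorGroundAmplitude L Δ M a) :
    energyQ L Δ (raiseSum a) - sectorE L Δ M * raiseNormSq a = (1 - Δ) * raiseCommW (torusGraph 2 L) a := by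
  set G := torusGraph 2 L
  set c : ℝ := sectorE L Δ M + (1/8 : ℝ) * ∑ x : TorusSite 2 L, ∑ y, if G.Adj x y then (1:ℝ) else 0 with hc
  -- A(S⁺a) = S⁺(A a) = c·S⁺a − (1−Δ)·S⁺(W a)
  have hA : ∀ σ, fmOp G (raiseSum a) σ = c * raiseSum a σ - (1 - Δ) * raiseSum (wMul G a) σ := by
    intro σ
    have h1 : fmOp G (raiseSum a) σ = raiseSum (fmOp G a) σ := by rw [raiseSum_fmOp]
    rw [h1, fmOp_perron_eq ha]
    rw [show (fun τ => (sectorE L Δ M + (1/8 : ℝ) * ∑ x : TorusSite 2 L, ∑ y, if G.Adj x y then (1:ℝ) else 0) * a τ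
        - (1 - Δ) * wMul G a τ) = fun τ => (fun τ => c * a τ) τ - (fun τ => (1 - Δ) * wMul G a τ) τ from rfl]
    rw [raiseSum_sub', raiseSum_smul, raiseSum_smul]
  rw [energyQ_eq_real]
  unfold raiseCommW raiseNormSq
  have hsum : ∑ σ, raiseSum a σ * (fmOp G (raiseSum a) σ + (1 - Δ) * (isingW G σ * raiseSum a σ))
      = c * ∑ σ, raiseSum a σ ^ 2 + (1 - Δ) * (∑ σ, isingW G σ * raiseSum a σ ^ 2
          - ∑ σ, raiseSum a σ * raiseSum (wMul G a) σ) := by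
    rw [mul_sub, Finset.mul_sum, Finset.mul_sum, Finset.mul_sum, ← Finset.sum_sub_distrib, ← Finset.sum_add_distrib]
    refine Finset.sum_congr rfl fun σ _ => ?_
    rw [hA σ]; ring
  rw [hsum, hc]
  unfold sectorE ham
  ring

/-- **LADDER EXCESS IDENTITY (lowering):** `⟨S⁻a, H S⁻a⟩ − E(M)‖S⁻a‖² = (1−Δ)·W⁻(a)`. [folklore] -/
theorem ladderExcess_lower {Δ M : ℝ} {a : TensorIndex (TorusSite 2 L) 2 → ℝ} (ha : IsPerronSectorGroundAmplitude L Δ M a) :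
    energyQ L Δ (lowerSum a) - sectorE L Δ M * lowerNormSq a = (1 - Δ) * lowerCommW (torusGraph 2 L) a := by
  set G := torusGraph 2 L
  set c : ℝ := sectorE L Δ M + (1/8 : ℝ) * ∑ x : TorusSite 2 L, ∑ y, if G.Adj x y then (1:ℝ) else 0 with hc
  have hA : ∀ σ, fmOp G (lowerSum a) σ = c * lowerSum a σ - (1 - Δ) * lowerSum (wMul G a) σ := by
    intro σ
    have h1 : fmOp G (lowerSum a) σ = lowerSum (fmOp G a) σ := by rw [lowerSum_fmOp]
    rw [h1, fmOp_perron_eq ha]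
    rw [show (fun τ => (sectorE L Δ M + (1/8 : ℝ) * ∑ x : TorusSite 2 L, ∑ y, if G.Adj x y then (1:ℝ) else 0) * a τ
        - (1 - Δ) * wMul G a τ) = fun τ => (fun τ => c * a τ) τ - (fun τ => (1 - Δ) * wMul G a τ) τ from rfl]
    rw [lowerSum_sub', lowerSum_smul, lowerSum_smul]
  rw [energyQ_eq_real]
  unfold lowerCommW lowerNormSq
  have hsum : ∑ σ, lowerSum a σ * (fmOp G (lowerSum a) σ + (1 - Δ) * (isingW G σ * lowerSum a σ))
      = c * ∑ σ, lowerSum a σ ^ 2 + (1 - Δ) * (∑ σ, isingW G σ * lowerSum a σ ^ 2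
          - ∑ σ, lowerSum a σ * lowerSum (wMul G a) σ) := by
    rw [mul_sub, Finset.mul_sum, Finset.mul_sum, Finset.mul_sum, ← Finset.sum_sub_distrib, ← Finset.sum_add_distrib]
    refine Finset.sum_congr rfl fun σ _ => ?_
    rw [hA σ]; ring
  rw [hsum, hc]
  unfold sectorE ham
  ring

/-- **LEMMA E REDUCED to a diagonal-operator commutator bound:** if `W⁺(a) + W⁻(a) ≤ 4L²` for every Perron sector amplitude on
every torus, then `LadderExcessBound`. [folklore] -/
theorem ladderExcessBound_of_commutatorBound
    (h : ∀ (L : ℕ) [NeZero L] (Δ M : ℝ) (a : TensorIndex (TorusSite 2 L) 2 → ℝ),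
      IsPerronSectorGroundAmplitude L Δ M a →
        raiseCommW (torusGraph 2 L) a + lowerCommW (torusGraph 2 L) a ≤ 4 * (L : ℝ) ^ 2) :
    LadderExcessBound := by
  intro L _ Δ M hΔ a ha
  rw [ladderExcess_raise ha, ladderExcess_lower ha, ← mul_add]
  have h1 := h L Δ M a ha
  have hη : 0 ≤ 1 - Δ := by linarith
  calc (1 - Δ) * (raiseCommW (torusGraph 2 L) a + lowerCommW (torusGraph 2 L) a)
      ≤ (1 - Δ) * (4 * (L : ℝ) ^ 2) := mul_le_mul_of_nonneg_left h1 hη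
    _ = 4 * (1 - Δ) * (L : ℝ) ^ 2 := by ring

end Torus

end Summit.HubbardSuperconductivity.HubbardSuperconductivity.Theorems.AnisotropyChord.Transfer
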